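import Summits.ResolutionOfSingularities.ResolutionOfSingularities.Theorems.EquisingularLiftEquisingularLiftNatTowerBExcTransportThrough
import Summits.ResolutionOfSingularities.ResolutionOfSingularities.Theorems.EquisingularLiftEquisingularLiftNatTowerBFourPointSteps
import Summits.ResolutionOfSingularities.ResolutionOfSingularities.Theorems.EquisingularLiftEquisingularLiftNatModelPointStepOfSection
import Literature.AlgebraicGeometry.Resolution.BlowupsExistence
import HarnessLib

/-!
# [OURS · L1 W4.5(b) · EL♮(3) · WIDTH TABLE D17 «STAGE-0 TOWER BOOKKEEPING», engine (pt-reg)₅ — CORES] `Tower.invB₄_pointStep₅` and `Tower.invB₄_ptRegStep_ofSection`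
# — the point step on `Tower.InvB₄` with members kept MODEL-CARRYING THROUGH the point, GIVEN the upstairs section on their models

res-L1-w45b-stub-4 g16 (STUB WORKER 4; desk RULING R81 (2) / g27-10 / g27-12 / R83 / g27-15 of 2026-08-29: (n1) ✓ p720136 `Tower.exc₄_transport_through`, then the
`(pt-reg)` closure of the RE-TYPED letter `TowerPtRegB₅` (E9′, res-type-027 `DefsE9prime_two_c` — two designated through-members `F₀`, `F₀'`, regular at the point,
crossing in PAIR-round currency) for res-L1-w45b-nose-w1's driver (n5)).  Crux EL♮(3) = stmt-ResolutionOfSingularities-20148 (parent EL♮ stmt-…-20038; bookkeeping crux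
stmt-…-15660).  OURS; NOT a statement of any manuscript ([Hironaka2017] is a candidate under adjudication, nothing of it is asserted); AI-written, weaker than expert
review.  DEF-FREE; no `sorry`; standard axioms; `--supports stmt-…-20148 --as helper`, counted 0.  EL♮(3) is NOT proved here.

WHAT (two cores; the explicit step `Tower.invB₄_ptRegStep₅` choosing the section is the next file …NatTowerBFourPointStepThrough).
* `Tower.invB₄_pointStep₅` — res-type-027's centre-agnostic core ✓ `Tower.invB₄_pointStep` (…NatTowerBFourPointSteps p625638) VERBATIM plus ONE GENERIC ARM in
  each of the `E'`- and `Es'`-menus: «a closed set of the new stage, not containing the new running curve, WITH A SUPPLIED `Exc₄` datum (shadow `∅`) in the new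
  stage» (for `E'` also `K' = ∅`) — the slot through which a THROUGH-member `St F` enters.  Proof = 027's, two more cases.
* ★ `Tower.invB₄_ptRegStep_ofSection` — the `(pt-reg)` step at an UNPACKED `Tower.InvB₄` stage GIVEN a section `ỹ = s : Spec O ⟶ X` through `jG y` and, for every
  member `F ∈ E :: Es` through `y` that an abstract guard `Thr F` allows to stay model-carrying, an OPENED model `𝓕` of `F` (its `Exc₄` clauses + the ruled datum)
  LYING UNDER THE SECTION (`𝓕 ≤ ker s`, `𝓕 ≠ ⊥`); menus = ✓ `Tower.invB₄_ptRegStep`'s with the through-guards `(curvePt G T y ∉ F ∨ Thr F)`.  Proof: blow `ker s` up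
  (Literature ✓ `exists_isBlowup`), ✓ `modelPointStep_of_section` (K3″), the centre meets the special fibre in `jG y` only (✓ `section_isClosedImmersion_and_isRegular_ker`,
  ✓ `disjoint_support_of_inter_fibre_eq_singleton`), the plane model ✓ `exists_planeModel`, every allowed through-member by (n1) ✓ `Tower.exc₄_transport_through`,
  then `Tower.invB₄_pointStep₅`.  STAND-INS (as in ✓ `Tower.invB₄_ptRegStep` + the round cores): `hRuledIso`, `hRuledBirth`, `hRuledSt`.
[cite: Liu2002, §8.1 and Thm. 8.1.19] [cite: GortzWedhorn2020, Prop. 13.91 (3) and (13.19)] (method; index only).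
-/

set_option linter.dupNamespace false -- mandated namespace `Summit.<Summit>.<Problem>` of this single-conjunct summit
set_option linter.overlappingInstances false -- the binders carry `[IsDomain O] [IsDiscreteValuationRing O]`

noncomputable section

open CategoryTheory CategoryTheory.Limits AlgebraicGeometry TopologicalSpace Topology IsLocalRing
open Literature.AlgebraicGeometry.Resolution
open AlgebraicGeometry.Scheme.IdealSheafData
open Summit.ResolutionOfSingularities.ResolutionOfSingularities.Theses.EquisingularLift.Split
open Summit.ResolutionOfSingularities.ResolutionOfSingularities.Cruxes.EquisingularLift.StrataSplit

namespace Summit.ResolutionOfSingularities.ResolutionOfSingularities.Cruxes.EquisingularLiftNat.Sections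

/-! ## The centre-agnostic core with the generic «supplied datum» arms -/

section PointStepCore5

variable (O : Type) [CommRing O] (k : Type) [Field k] (θ : O →+* k) (P : Scheme.{0}) (q : P ⟶ Spec (.of O)) (Y : Set P)
  (Ch : ∀ X' : Scheme.{0}, (X' ⟶ P) → Set X' → Prop) (Ruled : Tower.RuledDatum P)
  {F₉ : Scheme.{0}} {Z₉ : Set F₉} {hZ₉ : IsClosed Z₉} {F₁₀ : Scheme.{0}} {υ' : F₁₀ ⟶ F₉}
  (hRuledIso : ∀ (G₀ G₀' : Scheme.{0}) (γ₀ : G₀ ⟶ F₁₀) (γ₀' : G₀' ⟶ F₁₀) (E₀ : Set G₀) (E₀' : Set G₀') (X₀ X₀'' : Scheme.{0})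
      (σ₀ : X₀ ⟶ P) (j₀ : G₀ ⟶ X₀) (j₀' : G₀' ⟶ X₀'') (𝓔₀ : X₀.IdealSheafData) (τ₀ : X₀'' ⟶ X₀),
    (∃ e : (𝓔₀.comap τ₀).subscheme ≅ 𝓔₀.subscheme, e.hom ≫ 𝓔₀.subschemeι = (𝓔₀.comap τ₀).subschemeι ≫ τ₀) →
    Ruled F₉ Z₉ hZ₉ F₁₀ υ' G₀ γ₀ E₀ X₀ σ₀ j₀ 𝓔₀ → Ruled F₉ Z₉ hZ₉ F₁₀ υ' G₀' γ₀' E₀' X₀'' (τ₀ ≫ σ₀) j₀' (𝓔₀.comap τ₀))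
  {G G' X X'' : Scheme.{0}} {γ : G ⟶ F₁₀} {T E : Set G} {Es : List (Set G)} {K : Set G}
  (hυ' : IsBlowup υ' (vanishingIdeal (⟨Z₉, hZ₉⟩ : Closeds F₉))) (hZ₉inf : Z₉.Infinite)
  {Ns : List (Set G)}
  (hTirr : IsIrreducible T) (hEcl : IsClosed E) (hTE : ¬ T ⊆ E) (hEsB : ∀ F ∈ Es, IsClosed F ∧ ¬ T ⊆ F)
  (hNsB : ∀ F ∈ Ns, IsClosed F ∧ ¬ T ⊆ F)
  {σ : X ⟶ P} {jG : G ⟶ X}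
  (hExc : ∀ hE : IsClosed E, Tower.Exc₄ O P q Y Ruled Z₉ hZ₉ υ' G γ E hE K X σ jG)
  (hExcF : ∀ F ∈ Es, ∀ hF : IsClosed F, Tower.Exc₄ O P q Y Ruled Z₉ hZ₉ υ' G γ F hF ∅ X σ jG)
  {pt : G} (hyc : IsClosed ({pt} : Set G)) (hTy : ¬ T ⊆ {pt}) {D : G.IdealSheafData} (hD : (D.support : Set G) = {pt})
  {υ₂ : G' ⟶ G} (hυ₂ : IsBlowup υ₂ D) [IsLocallyNoetherian G] [IsLocallyNoetherian X] [IsLocallyNoetherian X'']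
  {τ : X'' ⟶ X} {C : X.IdealSheafData} (hτ : IsBlowup τ C)
  (hdisj : ∀ I : X.IdealSheafData, jG pt ∉ (I.support : Set X) → Disjoint (I.support : Set X) (C.support : Set X))
  {j₂ : G' ⟶ X''} {t₂ : G' ⟶ Spec (.of k)} (hcomm : j₂ ≫ τ = υ₂ ≫ jG)
  {S'' : Set X''} (hCh'' : Ch X'' (τ ≫ σ) S'') [IsIntegral X''] (hX''reg : Scheme.IsRegular X'') (hdom'' : IsDominant ((τ ≫ σ) ≫ q))
  (hsq₂ : IsPullback j₂ t₂ ((τ ≫ σ) ≫ q) (Spec.map (CommRingCat.ofHom θ)))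
  (hsets : j₂ '' closure (υ₂ ⁻¹' (T \ {pt})) = S'') [IsIntegral G'] (hT'irr : IsIrreducible (closure (υ₂ ⁻¹' (T \ {pt}))))

include hRuledIso hυ' hZ₉inf hTirr hEcl hTE hEsB hNsB hExc hExcF hyc hTy hD hυ₂ hτ hdisj hcomm hCh'' hX''reg hdom'' hsq₂ hsets hT'irr

/-- **`Tower.invB₄_pointStep₅` — a point step on `Tower.InvB₄` at an explicit stage step, WITH the generic «supplied datum» arms**: res-type-027's ✓
`Tower.invB₄_pointStep` (menus: `K'` as in B; `E'` = the new plane with its model ∨ `St E` off the point ∨ the switch to a retained member off the point;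
`Es'` = B-AWAY transports ∨ the new plane with its model; `Ns'` topological) plus, in the `E'`-menu and the `Es'`-menu, the arm «a closed `F' ⊉ T'` of `G'`
WITH an `Exc₄` datum (shadow `∅`) in the new stage `(X'', τ ≫ σ, j₂)`» — the slot through which the (T1) THROUGH-member `St F₀` (model by (n1)
`Tower.exc₄_transport_through`) enters.  Proof = 027's, two more cases. [cite: Liu2002, §8.1 and Thm. 8.1.19] [cite: GortzWedhorn2020, Prop. 13.91 (3) and (13.19)]
[OURS · L1 W4.5b · D17 engine]; NOT a statement of the manuscript. -/
theorem Tower.invB₄_pointStep₅ (K' E' : Set G') (Es' Ns' : List (Set G'))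
    (hK' : K' = ∅ ∨ (pt ∉ closure K ∧ K' = closure (υ₂ ⁻¹' (K \ {pt}))))
    (hE' : (E' = υ₂ ⁻¹' {pt} ∧ ∀ hE'' : IsClosed (υ₂ ⁻¹' ({pt} : Set G)),
        Tower.Exc₄ O P q Y Ruled Z₉ hZ₉ υ' G' (υ₂ ≫ γ) (υ₂ ⁻¹' {pt}) hE'' ∅ X'' (τ ≫ σ) j₂) ∨
      (pt ∉ E ∧ E' = closure (υ₂ ⁻¹' (E \ {pt}))) ∨
      (∃ F ∈ E :: Es, pt ∉ F ∧ E' = closure (υ₂ ⁻¹' (F \ {pt})) ∧ K' = ∅) ∨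
      (IsClosed E' ∧ ¬ closure (υ₂ ⁻¹' (T \ {pt})) ⊆ E' ∧
        (∀ hE'' : IsClosed E', Tower.Exc₄ O P q Y Ruled Z₉ hZ₉ υ' G' (υ₂ ≫ γ) E' hE'' ∅ X'' (τ ≫ σ) j₂) ∧ K' = ∅))
    (hEs' : ∀ F' ∈ Es', (∃ F ∈ E :: Es, pt ∉ F ∧ F' = closure (υ₂ ⁻¹' (F \ {pt}))) ∨
      (F' = υ₂ ⁻¹' {pt} ∧ ∀ hE'' : IsClosed (υ₂ ⁻¹' ({pt} : Set G)),
        Tower.Exc₄ O P q Y Ruled Z₉ hZ₉ υ' G' (υ₂ ≫ γ) (υ₂ ⁻¹' {pt}) hE'' ∅ X'' (τ ≫ σ) j₂) ∨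
      (IsClosed F' ∧ ¬ closure (υ₂ ⁻¹' (T \ {pt})) ⊆ F' ∧
        ∀ hF'' : IsClosed F', Tower.Exc₄ O P q Y Ruled Z₉ hZ₉ υ' G' (υ₂ ≫ γ) F' hF'' ∅ X'' (τ ≫ σ) j₂))
    (hNs' : ∀ F' ∈ Ns', (∃ F ∈ (E :: Es) ++ Ns, F' = closure (υ₂ ⁻¹' (F \ {pt}))) ∨ F' = υ₂ ⁻¹' {pt}) :
    Tower.InvB₄ O k θ P q Y Ch Ruled F₉ Z₉ hZ₉ F₁₀ υ' G' (υ₂ ≫ γ) (closure (υ₂ ⁻¹' (T \ {pt}))) E' Es' Ns' K' := by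
  -- adapted from res-type-027's `Tower.invB₄_pointStep` (…NatTowerBFourPointSteps): two more (generic) cases
  -- every member of `E :: Es`: closed, `T ⊄ F`, shadow-forgotten MODEL datum
  have hmem : ∀ F ∈ E :: Es, ∃ hF : IsClosed F, ¬ T ⊆ F ∧ Tower.Exc₄ O P q Y Ruled Z₉ hZ₉ υ' G γ F hF ∅ X σ jG := by
    intro F hF
    rcases List.mem_cons.mp hF with rfl | hF
    · exact ⟨hEcl, hTE, Tower.exc₄_forgetShadow O P q Y Ruled (hExc hEcl)⟩
    · exact ⟨(hEsB F hF).1, (hEsB F hF).2, hExcF F hF (hEsB F hF).1⟩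
  -- every member of `E :: Es ++ Ns`: closed and `T ⊄ F`
  have hmemAll : ∀ F ∈ (E :: Es) ++ Ns, IsClosed F ∧ ¬ T ⊆ F := by
    intro F hF
    rcases List.mem_append.mp hF with hF | hF
    · obtain ⟨hFcl, hTF, -⟩ := hmem F hF
      exact ⟨hFcl, hTF⟩
    · exact hNsB F hF
  -- the pointwise ruled transports the bricks ask for
  have hRuledPt : ∀ (G₀ G₀' : Scheme.{0}) (γ₀ : G₀ ⟶ F₁₀) (E₀ : Set G₀) (X₀ X₀'' : Scheme.{0}) (σ₀ : X₀ ⟶ P) (j₀ : G₀ ⟶ X₀)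
      (j₀' : G₀' ⟶ X₀'') (t₀' : G₀' ⟶ Spec (.of k)) (𝓔₀ : X₀.IdealSheafData) (τ₀ : X₀'' ⟶ X₀) (υ₀ : G₀' ⟶ G₀) (y₀ : G₀),
      j₀' ≫ τ₀ = υ₀ ≫ j₀ → IsPullback j₀' t₀' ((τ₀ ≫ σ₀) ≫ q) (Spec.map (CommRingCat.ofHom θ)) → y₀ ∉ E₀ →
      (∃ e : (𝓔₀.comap τ₀).subscheme ≅ 𝓔₀.subscheme, e.hom ≫ 𝓔₀.subschemeι = (𝓔₀.comap τ₀).subschemeι ≫ τ₀) →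
      Ruled F₉ Z₉ hZ₉ F₁₀ υ' G₀ γ₀ E₀ X₀ σ₀ j₀ 𝓔₀ →
      Ruled F₉ Z₉ hZ₉ F₁₀ υ' G₀' (υ₀ ≫ γ₀) (closure (υ₀ ⁻¹' (E₀ \ {y₀}))) X₀'' (τ₀ ≫ σ₀) j₀' (𝓔₀.comap τ₀) :=
    fun G₀ G₀' γ₀ E₀ X₀ X₀'' σ₀ j₀ j₀' _ 𝓔₀ τ₀ υ₀ y₀ _ _ _ he hR => hRuledIso G₀ G₀' γ₀ _ E₀ _ X₀ X₀'' σ₀ j₀ j₀' 𝓔₀ τ₀ he hR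
  have hRuledAway : ∀ (F : Set G) (𝓕 : X.IdealSheafData),
      (∃ e : (𝓕.comap τ).subscheme ≅ 𝓕.subscheme, e.hom ≫ 𝓕.subschemeι = (𝓕.comap τ).subschemeι ≫ τ) →
      Ruled F₉ Z₉ hZ₉ F₁₀ υ' G γ F X σ jG 𝓕 →
      Ruled F₉ Z₉ hZ₉ F₁₀ υ' G' (υ₂ ≫ γ) (closure (υ₂ ⁻¹' (F \ {pt}))) X'' (τ ≫ σ) j₂ (𝓕.comap τ) :=
    fun F 𝓕 he hR => hRuledIso G G' γ _ F _ X X'' σ jG j₂ 𝓕 τ he hR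
  -- `T' ⊄ υ₂⁻¹{pt}` (a point of `T` off `pt` lifts)
  have hTnew : ¬ closure (υ₂ ⁻¹' (T \ {pt})) ⊆ υ₂ ⁻¹' {pt} := by
    obtain ⟨t, htT, htne⟩ := Set.not_subset.mp hTy
    have htJ : t ∉ (D.support : Set G) := by rw [hD]; exact htne
    obtain ⟨t₂, ht₂⟩ := exists_preimage_of_not_mem_support υ₂ D hυ₂ htJ
    intro hsub
    have h1 : t₂ ∈ closure (υ₂ ⁻¹' (T \ {pt})) := subset_closure (by rw [Set.mem_preimage, ht₂]; exact ⟨htT, htne⟩)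
    have h2 := hsub h1
    rw [Set.mem_preimage, ht₂] at h2
    exact htne h2
  -- the model-carrying list: bookkeeping and the B-AWAY transport / the new plane's model / the supplied datum, member by member
  have hEs'B : ∀ F' ∈ Es', IsClosed F' ∧ ¬ closure (υ₂ ⁻¹' (T \ {pt})) ⊆ F' := by
    intro F' hF'
    rcases hEs' F' hF' with ⟨F, hFmem, hptF, rfl⟩ | ⟨rfl, -⟩ | ⟨hF'cl, hTF', -⟩
    · obtain ⟨hF, hTF, -⟩ := hmem F hFmem
      exact ⟨isClosed_closure, not_closure_preimage_diff_subset hυ₂ hTirr hF hyc hTF hTy hD.le⟩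
    · exact ⟨hyc.preimage υ₂.continuous, hTnew⟩
    · exact ⟨hF'cl, hTF'⟩
  have hEs'Exc : ∀ F' ∈ Es', ∀ hF' : IsClosed F',
      Tower.Exc₄ O P q Y Ruled Z₉ hZ₉ υ' G' (υ₂ ≫ γ) F' hF' ∅ X'' (τ ≫ σ) j₂ := by
    intro F' hF'
    rcases hEs' F' hF' with ⟨F, hFmem, hptF, rfl⟩ | ⟨rfl, hplane⟩ | ⟨-, -, hdat⟩
    · obtain ⟨hF, -, hExcF0⟩ := hmem F hFmem
      refine Tower.exc₄_transport_away O P q Y Ruled hτ hυ₂ hD hcomm hRuledAway hF hExcF0 (Set.disjoint_singleton_left.mpr hptF) fun 𝓕 h𝓕 => hdisj 𝓕 ?_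
      intro hmemsupp
      have h1 : pt ∈ ((𝓕.comap jG).support : Set G) := by rw [support_comap]; exact hmemsupp
      rw [h𝓕, Scheme.IdealSheafData.coe_support_vanishingIdeal] at h1
      exact hptF h1
    · exact hplane
    · exact hdat
  -- the model-less list: bookkeeping only
  have hNs'B : ∀ F' ∈ Ns', IsClosed F' ∧ ¬ closure (υ₂ ⁻¹' (T \ {pt})) ⊆ F' := by
    intro F' hF'
    rcases hNs' F' hF' with ⟨F, hFmem, rfl⟩ | rfl
    · obtain ⟨hF, hTF⟩ := hmemAll F hFmem
      exact ⟨isClosed_closure, not_closure_preimage_diff_subset hυ₂ hTirr hF hyc hTF hTy hD.le⟩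
    · exact ⟨hyc.preimage υ₂.continuous, hTnew⟩
  -- the running surface
  rcases hE' with ⟨rfl, hplane⟩ | ⟨hyE, rfl⟩ | ⟨F, hFmem, hptF, rfl, rfl⟩ | ⟨hE'cl, hTE', hdat, rfl⟩
  rotate_right
  · -- SUPPLIED DATUM (the THROUGH-member of (T1), or any closed `E' ⊉ T'` modelled in the new stage), shadow dropped
    exact ⟨hυ', hZ₉inf, inferInstance, isClosed_closure, hT'irr, hE'cl, hTE', hEs'B, hNs'B, X'', τ ≫ σ, _, j₂, t₂, hCh'',
      inferInstance, inferInstance, hX''reg, hdom'', hsq₂, hsets, fun hE'' => hdat hE'', hEs'Exc⟩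
  rotate_right
  · -- SWITCH: the running surface becomes the transported retained member `St F` (`pt ∉ F`), shadow dropped
    obtain ⟨hF, hTF, hExcF0⟩ := hmem F hFmem
    have hTE' : ¬ closure (υ₂ ⁻¹' (T \ {pt})) ⊆ closure (υ₂ ⁻¹' (F \ {pt})) :=
      not_closure_preimage_diff_subset hυ₂ hTirr hF hyc hTF hTy hD.le
    refine ⟨hυ', hZ₉inf, inferInstance, isClosed_closure, hT'irr, isClosed_closure, hTE', hEs'B, hNs'B, X'', τ ≫ σ, _, j₂, t₂, hCh'',
      inferInstance, inferInstance, hX''reg, hdom'', hsq₂, hsets, fun hE'' => ?_, hEs'Exc⟩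
    refine Tower.exc₄_transport_away O P q Y Ruled hτ hυ₂ hD hcomm hRuledAway hF hExcF0 (Set.disjoint_singleton_left.mpr hptF)
      (fun 𝓕 h𝓕 => hdisj 𝓕 ?_) hE''
    intro hmemsupp
    have h1 : pt ∈ ((𝓕.comap jG).support : Set G) := by rw [support_comap]; exact hmemsupp
    rw [h𝓕, Scheme.IdealSheafData.coe_support_vanishingIdeal] at h1
    exact hptF h1
  · -- NEW PLANE `E' = υ₂⁻¹{pt}` WITH ITS MODEL; shadow `∅` or the TRIVIAL cone when `K' = St K` misses the plane
    refine ⟨hυ', hZ₉inf, inferInstance, isClosed_closure, hT'irr, hyc.preimage υ₂.continuous, hTnew, hEs'B, hNs'B, X'', τ ≫ σ, _, j₂, t₂,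
      hCh'', inferInstance, inferInstance, hX''reg, hdom'', hsq₂, hsets, fun hE'' => ?_, hEs'Exc⟩
    rcases hK' with rfl | ⟨hyK, rfl⟩
    · exact hplane hE''
    · refine Tower.exc₄_shadow_of_disjoint O P q Y Ruled (hplane hE'') ?_
      rw [isClosed_closure.closure_eq]
      refine Set.disjoint_left.mpr fun z hz hzK => ?_
      have hsub : closure (υ₂ ⁻¹' (K \ {pt})) ⊆ υ₂ ⁻¹' closure K :=
        closure_minimal (fun w hw => subset_closure hw.1) (isClosed_closure.preimage υ₂.continuous)
      have h1 := hsub hzK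
      rw [Set.mem_preimage] at h1 hz
      rw [Set.mem_singleton_iff] at hz
      rw [hz] at h1
      exact hyK h1
  · -- TRANSPORTED SURFACE `E' = closure υ₂⁻¹(E ∖ {pt})` (the point is OFF `E`)
    have hTE' : ¬ closure (υ₂ ⁻¹' (T \ {pt})) ⊆ closure (υ₂ ⁻¹' (E \ {pt})) :=
      not_closure_preimage_diff_subset hυ₂ hTirr hEcl hyc hTE hTy hD.le
    refine ⟨hυ', hZ₉inf, inferInstance, isClosed_closure, hT'irr, isClosed_closure, hTE', hEs'B, hNs'B, X'', τ ≫ σ, _, j₂, t₂, hCh'',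
      inferInstance, inferInstance, hX''reg, hdom'', hsq₂, hsets, ?_, hEs'Exc⟩
    rcases hK' with rfl | ⟨hyK, rfl⟩
    · have hExc0 : ∀ hE : IsClosed E, Tower.Exc₄ O P q Y Ruled Z₉ hZ₉ υ' G γ E hE (∅ : Set G) X σ jG :=
        fun hE => Tower.exc₄_forgetShadow O P q Y Ruled (hExc hE)
      have h := Tower.exc₄_pointCentre_transport O k θ P q Y Ruled hEcl hExc0 hD hυ₂ hτ hdisj hcomm hsq₂ hRuledPt hyE (Or.inl rfl)
      simpa only [Set.empty_sdiff, Set.preimage_empty, closure_empty] using h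
    · exact Tower.exc₄_pointCentre_transport O k θ P q Y Ruled hEcl hExc hD hυ₂ hτ hdisj hcomm hsq₂ hRuledPt hyE (Or.inr hyK)

end PointStepCore5

/-! ## The `(pt-reg)` step GIVEN the section on the through-members' models -/

section OfSection

variable (O : Type) [CommRing O] [IsDomain O] [IsDiscreteValuationRing O] (k : Type) [Field k] (θ : O →+* k) (hθ : Function.Surjective θ)
  (P : Scheme.{0}) (q : P ⟶ Spec (.of O)) (Y : Set P) (hYsp : Y ⊆ q ⁻¹' {closedPoint O}) (hYirr : IsIrreducible Y)
  (hYcl : IsClosed Y) [IsProper q] (hPnoeth : IsLocallyNoetherian P) (hPreg : Scheme.IsRegular P)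
  (Ch : ∀ X' : Scheme.{0}, (X' ⟶ P) → Set X' → Prop)
  (hChain : ∀ (X' : Scheme.{0}) (σ : X' ⟶ P) (S : Set X'), Ch X' σ S → Chain P Y X' σ S)
  (hStep : ∀ (X' X'' : Scheme.{0}) (σ' : X' ⟶ P) (S' : Set X') (C : X'.IdealSheafData) (τ : X'' ⟶ X'),
    Ch X' σ' S' → IsBlowup τ C → Scheme.IsRegular C.subscheme → Flat (C.subschemeι ≫ σ' ≫ q) →
    σ' '' (C.support : Set X') ⊆ {x : P | ¬ IsGenericPoint x Y} →
    (C.support : Set X') ∩ (σ' ≫ q) ⁻¹' {closedPoint O} ⊆ S' →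
    Ch X'' (τ ≫ σ') (closure (τ ⁻¹' (S' \ (C.support : Set X')))))
  (Ruled : Tower.RuledDatum P) {F₉ : Scheme.{0}} (Z₉ : Set F₉) (hZ₉ : IsClosed Z₉) {F₁₀ : Scheme.{0}} (υ' : F₁₀ ⟶ F₉)
  (hRuledIso : ∀ (G₀ G₀' : Scheme.{0}) (γ₀ : G₀ ⟶ F₁₀) (γ₀' : G₀' ⟶ F₁₀) (E₀ : Set G₀) (E₀' : Set G₀') (X₀ X₀'' : Scheme.{0})
      (σ₀ : X₀ ⟶ P) (j₀ : G₀ ⟶ X₀) (j₀' : G₀' ⟶ X₀'') (𝓔₀ : X₀.IdealSheafData) (τ₀ : X₀'' ⟶ X₀),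
    (∃ e : (𝓔₀.comap τ₀).subscheme ≅ 𝓔₀.subscheme, e.hom ≫ 𝓔₀.subschemeι = (𝓔₀.comap τ₀).subschemeι ≫ τ₀) →
    Ruled F₉ Z₉ hZ₉ F₁₀ υ' G₀ γ₀ E₀ X₀ σ₀ j₀ 𝓔₀ → Ruled F₉ Z₉ hZ₉ F₁₀ υ' G₀' γ₀' E₀' X₀'' (τ₀ ≫ σ₀) j₀' (𝓔₀.comap τ₀))
  -- T23-A′: the ruled datum follows STRICT TRANSFORMS under blow-ups (at `FE`: res-L1-w45b-stub-2's `flat_strictTransform_subschemeι_comp_stage`)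
  (hRuledSt : ∀ (G₀ G₀' : Scheme.{0}) (γ₀ : G₀ ⟶ F₁₀) (γ₀' : G₀' ⟶ F₁₀) (E₀ : Set G₀) (E₀' : Set G₀') (X₀ X₀'' : Scheme.{0})
      (σ₀ : X₀ ⟶ P) (j₀ : G₀ ⟶ X₀) (j₀' : G₀' ⟶ X₀'') (𝓔₀ C₀ : X₀.IdealSheafData) (τ₀ : X₀'' ⟶ X₀),
    IsBlowup τ₀ C₀ → IsLocallyNoetherian X₀ → IsLocallyNoetherian X₀'' →
    Ruled F₉ Z₉ hZ₉ F₁₀ υ' G₀ γ₀ E₀ X₀ σ₀ j₀ 𝓔₀ →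
    Ruled F₉ Z₉ hZ₉ F₁₀ υ' G₀' γ₀' E₀' X₀'' (τ₀ ≫ σ₀) j₀' (strictTransformIdeal τ₀ C₀ 𝓔₀))
  (hRuledBirth : ∀ (G₀ G₀' : Scheme.{0}) (γ₀' : G₀' ⟶ F₁₀) (E₀' : Set G₀') (X₀ X₀'' : Scheme.{0}) (σ₀ : X₀ ⟶ P) (j₀' : G₀' ⟶ X₀'')
      (s₀ : Spec (.of O) ⟶ X₀) (τ₀ : X₀'' ⟶ X₀),
    IsBlowup τ₀ s₀.ker → Flat ((s₀.ker.comap τ₀).subschemeι ≫ (τ₀ ≫ σ₀) ≫ q) →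
    Ruled F₉ Z₉ hZ₉ F₁₀ υ' G₀' γ₀' E₀' X₀'' (τ₀ ≫ σ₀) j₀' (s₀.ker.comap τ₀))
  -- the guard: which members through the point may stay model-carrying
  (Thr : ∀ {G : Scheme.{0}}, Set G → Prop)
  (G G' : Scheme.{0}) (γ : G ⟶ F₁₀) (T E : Set G) (Es Ns : List (Set G)) (K : Set G)
  (y : redSub G (closure T) isClosed_closure) (υ₂ : G' ⟶ G) (hyc : IsClosed ({curvePt G T y} : Set G))
  (K' E' : Set G') (Es' Ns' : List (Set G'))
  -- the old invariant UNPACKED at its stage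
  (hυ' : IsBlowup υ' (vanishingIdeal (⟨Z₉, hZ₉⟩ : Closeds F₉))) (hZ₉inf : Z₉.Infinite) [IsIntegral G]
  (hTcl : IsClosed T) (hTirr : IsIrreducible T) (hEcl : IsClosed E) (hTE : ¬ T ⊆ E) (hEsB : ∀ F ∈ Es, IsClosed F ∧ ¬ T ⊆ F)
  (hNsB : ∀ F ∈ Ns, IsClosed F ∧ ¬ T ⊆ F)
  (X : Scheme.{0}) (σ : X ⟶ P) (S : Set X) (jG : G ⟶ X) (tG : G ⟶ Spec (.of k))
  (hCh : Ch X σ S) [IsIntegral X] [IsLocallyNoetherian X] (hXreg : Scheme.IsRegular X) (hdom : IsDominant (σ ≫ q))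
  (hsq : IsPullback jG tG (σ ≫ q) (Spec.map (CommRingCat.ofHom θ))) (hTS : jG '' T = S)
  (hExc : ∀ hE : IsClosed E, Tower.Exc₄ O P q Y Ruled Z₉ hZ₉ υ' G γ E hE K X σ jG)
  (hExcF : ∀ F ∈ Es, ∀ hF : IsClosed F, Tower.Exc₄ O P q Y Ruled Z₉ hZ₉ υ' G γ F hF ∅ X σ jG)
  -- the `(pt-reg)` point and its blow-up
  (hTreg : ¬ IsRegularLocalRing ((redSub G (closure T) isClosed_closure).presheaf.stalk y))
  (hGreg : IsRegularLocalRing (G.presheaf.stalk (curvePt G T y)))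
  (hυ₂ : IsBlowup υ₂ (vanishingIdeal (⟨{curvePt G T y}, hyc⟩ : Closeds G)))
  -- the SECTION through `jG y`, and the OPENED models of the allowed through-members lying under it
  (s : Spec (.of O) ⟶ X) (hs : s ≫ σ ≫ q = 𝟙 _) (hss₀ : s (closedPoint O) = jG (curvePt G T y))
  (hthr : ∀ F ∈ E :: Es, Thr F → curvePt G T y ∈ F → ∃ (hF : IsClosed F) (𝓕 : X.IdealSheafData),
    𝓕.comap jG = vanishingIdeal (⟨F, hF⟩ : Closeds G) ∧ (∀ z : X, (stalkIdeal 𝓕 z).IsPrincipal) ∧ Scheme.IsRegular 𝓕.subscheme ∧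
    σ '' (𝓕.support : Set X) ⊆ {p : P | ¬ IsGenericPoint p Y} ∧ Ruled F₉ Z₉ hZ₉ F₁₀ υ' G γ F X σ jG 𝓕 ∧ 𝓕 ≤ s.ker ∧ 𝓕 ≠ ⊥)
  -- the menus, through-guards `(curvePt G T y ∉ F ∨ Thr F)`
  (hK' : K' = ∅ ∨ (curvePt G T y ∉ closure K ∧ K' = closure (υ₂ ⁻¹' (K \ {curvePt G T y}))))
  (hE' : E' = υ₂ ⁻¹' {curvePt G T y} ∨ (curvePt G T y ∉ E ∧ E' = closure (υ₂ ⁻¹' (E \ {curvePt G T y}))) ∨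
    (∃ F ∈ E :: Es, (curvePt G T y ∉ F ∨ Thr F) ∧ E' = closure (υ₂ ⁻¹' (F \ {curvePt G T y})) ∧ K' = ∅))
  (hEs' : ∀ F' ∈ Es', (∃ F ∈ E :: Es, (curvePt G T y ∉ F ∨ Thr F) ∧ F' = closure (υ₂ ⁻¹' (F \ {curvePt G T y}))) ∨
    F' = υ₂ ⁻¹' {curvePt G T y})
  (hNs' : ∀ F' ∈ Ns', (∃ F ∈ (E :: Es) ++ Ns, F' = closure (υ₂ ⁻¹' (F \ {curvePt G T y}))) ∨ F' = υ₂ ⁻¹' {curvePt G T y})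

include hθ hYsp hYirr hYcl hPnoeth hPreg hChain hStep hRuledIso hRuledSt hRuledBirth hTcl hEcl hTE hEsB hNsB hCh hXreg hdom hsq hTS hExc hExcF
  hTreg hGreg hυ₂ hs hss₀ hthr hK' hE' hEs' hNs' hυ' hZ₉inf hTirr

/-- ★ **`Tower.invB₄_ptRegStep_ofSection` — the `(pt-reg)` step on an unpacked `Tower.InvB₄` stage GIVEN THE UPSTAIRS SECTION `ỹ` through `jG y` and, for
every member through `y` that the guard `Thr` keeps model-carrying, an opened model lying UNDER the section.**  Upstairs = the blow-up of `ker ỹ`; new plane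
modelled by `(ker ỹ)·𝒪_{X''}`, allowed through-members by their strict transforms ((n1) ✓ `Tower.exc₄_transport_through`), members off the point by B-AWAY,
the running surface / the shadow / `Ns` as in ✓ `Tower.invB₄_ptRegStep`. [cite: Liu2002, §8.1 and Thm. 8.1.19] [cite: GortzWedhorn2020, Prop. 13.91 (3) and (13.19)]
[OURS · L1 W4.5b · D17 engine (pt-reg)₅ core]; NOT a statement of the manuscript. -/
theorem Tower.invB₄_ptRegStep_ofSection :
    Tower.InvB₄ O k θ P q Y Ch Ruled F₉ Z₉ hZ₉ F₁₀ υ' G' (υ₂ ≫ γ) (closure (υ₂ ⁻¹' (T \ {curvePt G T y}))) E' Es' Ns' K' := by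
  classical
  -- chain facts at the stage
  haveI := hdom
  obtain ⟨-, -, hσ⟩ := chain_isRegular P Y X σ S (hChain _ _ _ hCh) hPnoeth hPreg
  haveI := hσ
  haveI hproper : IsProper (σ ≫ q) := inferInstance
  haveI : IsSeparated (σ ≫ q) := inferInstance
  haveI : IsClosedImmersion (Spec.map (CommRingCat.ofHom θ)) := IsClosedImmersion.spec_of_surjective _ hθ
  haveI hjci : IsClosedImmersion jG := MorphismProperty.IsStableUnderBaseChange.of_isPullback hsq.flip inferInstance
  haveI hGnoeth : IsLocallyNoetherian G := LocallyOfFiniteType.isLocallyNoetherian jG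
  have hyT : curvePt G T y ∈ T := subschemeι_mem_of_isClosed hTcl y
  have hTy : ¬ T ⊆ {curvePt G T y} := not_subset_singleton_of_not_isRegularLocalRing_stalk y hTreg hyc
  have hjyc : IsClosed ({jG (curvePt G T y)} : Set X) := by
    simpa only [Set.image_singleton] using hjci.isClosedEmbedding.isClosedMap _ hyc
  have hyoff : ¬ IsGenericPoint (σ (jG (curvePt G T y))) Y :=
    not_isGenericPoint_of_image_eq (hChain _ _ _ hCh) jG hjci.isClosedEmbedding.injective hTS hjyc hTy
  have hjsp : (σ ≫ q) (jG (curvePt G T y)) = closedPoint O := by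
    have h1 : jG (curvePt G T y) ∈ Set.range jG := ⟨_, rfl⟩
    rw [range_eq_preimage_of_isPullback hsq, range_specMap_of_surjective_of_field θ hθ] at h1
    exact h1
  have hs' : s ≫ σ ≫ q = 𝟙 _ := hs
  -- the point step WITH THIS SECTION: blow up `ker s`, K3″ `modelPointStep_of_section`
  obtain ⟨X'', τ, hτ⟩ := exists_isBlowup X s.ker
  obtain ⟨hCh'', hreg'', hnoeth'', hint'', hdom'', hG'int, hT'irr, hCD, hsoff, hsreg, hsflat, j₂, t₂, hsq₂, hcomm, -, hsets⟩ :=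
    modelPointStep_of_section O k θ hθ P q Y hYsp hYirr hYcl Ch hChain hStep X σ S hCh hXreg hdom G jG tG hsq T hTS (curvePt G T y) hyc
      hyT hTy hyoff s hs' hss₀ X'' τ hτ G' υ₂ hυ₂
  haveI := hnoeth''
  haveI := hint''
  haveI := hG'int
  haveI : IsLocallyNoetherian G' := hυ₂.isLocallyNoetherian
  -- the centre meets the special fibre in `jG y` only; hence it misses every closed subscheme not through `jG y`
  obtain ⟨_, -, -, hCsupp⟩ := section_isClosedImmersion_and_isRegular_ker O X (σ ≫ q) s hs'
  have hCb : (s.ker.support : Set X) ∩ (σ ≫ q) ⁻¹' {closedPoint O} = {jG (curvePt G T y)} := by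
    ext z
    constructor
    · rintro ⟨hz, hzsp⟩
      rw [hCsupp] at hz
      obtain ⟨p, rfl⟩ := hz
      have hp : p = closedPoint O := by
        have h1 : (s ≫ σ ≫ q) p = p := by rw [hs']; rfl
        rw [Scheme.Hom.comp_apply] at h1
        rw [← h1]; exact hzsp
      rw [Set.mem_singleton_iff, hp, hss₀]
    · rintro rfl
      refine ⟨?_, hjsp⟩
      rw [hCsupp, ← hss₀]; exact ⟨_, rfl⟩
  have hdisj : ∀ I : X.IdealSheafData, jG (curvePt G T y) ∉ (I.support : Set X) → Disjoint (I.support : Set X) (s.ker.support : Set X) :=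
    fun I hI => disjoint_support_of_inter_fibre_eq_singleton (σ ≫ q) s.ker I hCb hI
  -- the plane model `(ker s)·𝒪_{X''}` of the new plane
  obtain ⟨𝓔p, rfl, hEi, hEii, hEiii, hEiv, hEfe, -⟩ :=
    exists_planeModel (Y := Y) hXreg hsreg hsflat hsoff hτ hyc hGreg hυ₂ hcomm hCD
  have hplane : ∀ hE'' : IsClosed (υ₂ ⁻¹' ({curvePt G T y} : Set G)),
      Tower.Exc₄ O P q Y Ruled Z₉ hZ₉ υ' G' (υ₂ ≫ γ) (υ₂ ⁻¹' {curvePt G T y}) hE'' ∅ X'' (τ ≫ σ) j₂ := fun hE'' =>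
    ⟨s.ker.comap τ, hEi hE'', hEii, hEiii, hEiv, hRuledBirth G G' (υ₂ ≫ γ) _ X X'' σ j₂ s τ hτ hEfe, Or.inl rfl⟩
  -- (n1): every allowed THROUGH-member keeps its model `St_τ 𝓕`
  have hRuledSt' : ∀ (F : Set G) (F' : Set G') (𝓕 : X.IdealSheafData), Ruled F₉ Z₉ hZ₉ F₁₀ υ' G γ F X σ jG 𝓕 →
      Ruled F₉ Z₉ hZ₉ F₁₀ υ' G' (υ₂ ≫ γ) F' X'' (τ ≫ σ) j₂ (strictTransformIdeal τ s.ker 𝓕) :=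
    fun F F' 𝓕 hR => hRuledSt G G' γ _ F F' X X'' σ jG j₂ 𝓕 _ τ hτ inferInstance inferInstance hR
  have hD : ((vanishingIdeal (⟨{curvePt G T y}, hyc⟩ : Closeds G) : G.IdealSheafData).support : Set G) = {curvePt G T y} :=
    Scheme.IdealSheafData.coe_support_vanishingIdeal _
  have hthrough : ∀ F ∈ E :: Es, Thr F → curvePt G T y ∈ F →
      IsClosed (closure (υ₂ ⁻¹' (F \ {curvePt G T y}))) ∧
      ¬ closure (υ₂ ⁻¹' (T \ {curvePt G T y})) ⊆ closure (υ₂ ⁻¹' (F \ {curvePt G T y})) ∧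
      ∀ hF' : IsClosed (closure (υ₂ ⁻¹' (F \ {curvePt G T y}))),
        Tower.Exc₄ O P q Y Ruled Z₉ hZ₉ υ' G' (υ₂ ≫ γ) (closure (υ₂ ⁻¹' (F \ {curvePt G T y}))) hF' ∅ X'' (τ ≫ σ) j₂ := by
    intro F hFmem hThr hyF
    obtain ⟨hF, 𝓕, he1, he2, he3, he4, he5, hle, h0⟩ := hthr F hFmem hThr hyF
    have hTF : ¬ T ⊆ F := by
      rcases List.mem_cons.mp hFmem with rfl | hFmem
      · exact hTE
      · exact (hEsB F hFmem).2
    exact ⟨isClosed_closure, not_closure_preimage_diff_subset hυ₂ hTirr hF hyc hTF hTy hD.le,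
      Tower.exc₄_transport_through O k θ hθ P q Y Ruled hXreg hsq s hs' hτ hyc hυ₂ hcomm hCD hss₀ hRuledSt' hF 𝓕 he1 he2 he3 he4 he5 hle h0⟩
  -- assemble: the core with the supplied-datum arms
  subst hTS
  refine Tower.invB₄_pointStep₅ O k θ P q Y Ch Ruled hRuledIso hυ' hZ₉inf hTirr hEcl hTE hEsB hNsB hExc hExcF hyc hTy hD hυ₂ hτ hdisj hcomm
    (S'' := j₂ '' closure (υ₂ ⁻¹' (T \ {curvePt G T y}))) (by rw [hsets]; exact hCh'') hreg'' hdom'' hsq₂ rfl hT'irr K' E' Es' Ns' hK' ?_ ?_ hNs'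
  · rcases hE' with h | h | ⟨F, hF, hor, hE, hK⟩
    · exact Or.inl ⟨h, hplane⟩
    · exact Or.inr (Or.inl h)
    · by_cases hyF : curvePt G T y ∈ F
      · have hThr : Thr F := hor.resolve_left (fun h => h hyF)
        obtain ⟨h1, h2, h3⟩ := hthrough F hF hThr hyF
        subst hE
        exact Or.inr (Or.inr (Or.inr ⟨h1, h2, h3, hK⟩))
      · exact Or.inr (Or.inr (Or.inl ⟨F, hF, hyF, hE, hK⟩))
  · intro F' hF'
    rcases hEs' F' hF' with ⟨F, hF, hor, hE⟩ | h
    · by_cases hyF : curvePt G T y ∈ F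
      · have hThr : Thr F := hor.resolve_left (fun h => h hyF)
        subst hE
        exact Or.inr (Or.inr (hthrough F hF hThr hyF))
      · exact Or.inl ⟨F, hF, hyF, hE⟩
    · exact Or.inr (Or.inl ⟨h, hplane⟩)

end OfSection

end Summit.ResolutionOfSingularities.ResolutionOfSingularities.Cruxes.EquisingularLiftNat.Sections

end
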